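import Mathlib
import Summits.AtomisticToContinuum.HydrodynamicLimit.Theorems.InformationPercolationEngineKickFairRelEquilibriumMesoLongWindowGlue
import Summits.AtomisticToContinuum.HydrodynamicLimit.Theorems.InformationPercolationEngineKickFairRelEquilibriumMesoClosePairCountLong
import Summits.AtomisticToContinuum.HydrodynamicLimit.Theorems.KickFairRelEquilibriumMeso.Negative.WindowAlgebra
import HarnessLib

/-!
# `KickFairRelEquilibriumMeso` — the rev-5 SPLIT glue
# `KickFairRelEquilibriumMeso_of_subs_rev5 : SingleKickBias rs → ShortFlightLG → SameWindowPairCovLong rs → KickFairRelEquilibriumMeso`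

Support file (`--supports stmt-AtomisticToContinuum-15177`, lead c8) preparing the route-level decomposition of the rank-2 crux
`Summit.AtomisticToContinuum.HydrodynamicLimit.Theses.InformationPercolationEngine.KickFairRelEquilibriumMeso` into the three sub-cruxes that are EXACTLY
the three open registered stubs of the line `Cruxes/KickFairRelEquilibriumMeso/Lines/kinetic_window_cut.lean` (rev 5b):

* `SingleKickBias rs` (B1) — the `LG`-conditional bias of one kick given its typed past, in Campbell-`L¹`; NECESSARY for the crux body
  (`singleKickBias_of_mesoBody`, p150031);
* `ShortFlightLG` (U) — the `LG`-mean of the normalised number of short-flight collisions is small (count debt; proved at constant profiles,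
  `shortFlightLG_rung0` p126384; implies `CountExcessLG`, p148642);
* `SameWindowPairCovLong rs` (SWL) — far same-window pairs of long-flight kicks are conditionally uncorrelated given the join of their typed pasts, in
  `N^{1/3}`-normalised pair-Campbell-`L¹` (at constant profiles ⟸ `FarPairDecorrelationLongConst`, p163327).

The implication is the composition, by name, of LANDED theorems: the rev-5 glue `stub_longWindowReduction : B1 → U → SWL → CPL → MesoBody rs` (p163816)
with the landed CPL `stub_closePairCountLong : ClosePairCountLong rs` (p164751), the definitional window algebra `kickFairRelEquilibriumMeso_iff` (p109023) and
the admissibility of the line's cell sequence `rs N = (N+1)^{-1/4}` (p109029). It is the sorry-free content of the skeleton theorem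
`KineticWindowCut.KickFairRelEquilibriumMeso_of` (rev 5b) stated over the three stub `Prop`s directly, so that
`route edit --split KickFairRelEquilibriumMeso --into SingleKickBias ShortFlightLG SameWindowPairCovLong` has its glue `C₁ → C₂ → C₃ → C` proved in the
tree before it is filed (companion of the rev-3 split glue `KickFairRelEquilibriumMeso_of_subs`, `…MesoSplit`). Hypothesis order = children order.
-/

noncomputable section

open MeasureTheory Set Filter Topology
open scoped ENNReal Classical

namespace Summit.AtomisticToContinuum.HydrodynamicLimit.Theorems.KickFairRelEquilibriumMesoLine

open Literature.Analysis.FluidPDE Literature.MathematicalPhysics.KineticTheory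
open Summit.AtomisticToContinuum.HydrodynamicLimit.Theorems.KickFairRelEquilibriumMesoNegative
  (MesoBody kickFairRelEquilibriumMeso_iff)

/-- **Rev-5 split glue for the crux `KickFairRelEquilibriumMeso`** (registered sub-goal `KickFairRelEquilibriumMeso_of_subs_rev5`): the single-kick
conditional bias bound B1, the short-flight count U and the same-window far-pair covariance SWL, along the line's admissible cell sequence
`rs N = (N+1)^{-1/4}`, imply the crux BY NAME — the landed glue and CPL give the body `MesoBody rs`, and the window algebra with the admissibility of `rs`
closes the `∃ rs` prefix. [folklore] -/
theorem KickFairRelEquilibriumMeso_of_subs_rev5 :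
    SingleKickBias rs → ShortFlightLG → SameWindowPairCovLong rs →
      Summit.AtomisticToContinuum.HydrodynamicLimit.Theses.InformationPercolationEngine.KickFairRelEquilibriumMeso :=
  fun hB1 hU hSWL =>
    kickFairRelEquilibriumMeso_iff.2
      ⟨rs, rs_pos, tendsto_rs, tendsto_succ_mul_rs_pow_three, stub_longWindowReduction hB1 hU hSWL stub_closePairCountLong⟩

end Summit.AtomisticToContinuum.HydrodynamicLimit.Theorems.KickFairRelEquilibriumMesoLine

end
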